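import Summits.CriticalPhenomena.PercolationContinuityZ3.Theses.PercShatteringRace
import Literature.Probability.Percolation.SharpnessDCTProofs
import Literature.Probability.Percolation.FiniteEnergy

/-!
# Crux `PercShatteringRace.NearLinearTwoClusterDecay` (stmt-CriticalPhenomena-5785), line `critical-orange-peeling` — stub `stub_shellIndependence`

Helper file for the crux skeleton `Cruxes/NearLinearTwoClusterDecay/Lines/critical_orange_peeling.lean`
(lead prover-line-stmt-CriticalPhenomena-5785-0). Proves exactly the registered stub signature
`stub_shellIndependence`; lands with `--supports stmt-CriticalPhenomena-5785`.

## The statement (disjoint-shell independence, Grimmett 1999 §2.2)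

For bond percolation `P_p = bondPercolation (zdGraph 3) p` on `ℤ³` and all `p, n, m, m'`:

`P_p(A₂(n, m) ∩ Sh(m, m')) ≤ P_p(A₂(n, m)) · P_p(Sh(m, m'))`,

where `A₂(n, m)` is the two-cluster event of the box `Λ(m) = box 3 m` (two sites of `Λ(n)`, each
joined inside `Λ(m)` to `∂ⁱⁿΛ(m)`, not joined to each other inside `Λ(m)`) and `Sh(m, m')` is the
shell event (the configuration restricted to the shell `Λ(m') ∖ Λ(m)` has two shell-distinct open
clusters joining the inner layer `Λ(m+1) ∖ Λ(m)` to `∂ⁱⁿΛ(m')`). Both events are spelled inline over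
the tree declarations `box`, `innerBoundary`, `openConnIn`.

## The argument (product measure)

Every atomic event `{x ⟷ y in S}` = `openConnIn S x y` is determined by the pairs inside `S`
(`DCT16.determinedBy_openConnIn`, with `S.sym2 ⊆ K`), hence so is any fixed Boolean / quantifier
combination of such events with the same `S` (transfer through `determinedBy_iff`). So `A₂(n, m)` is
determined by the finite pair set `(box 3 m).sym2` and `Sh(m, m')` by `(box 3 m' \ box 3 m).sym2`;
these two `Finset`s of pairs are disjoint (a common pair would have an endpoint both in `Λ(m)` and in
`Λ(m') ∖ Λ(m)`), and events determined by disjoint finite pair sets are independent under the product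
measure (`DCT16.real_inter_of_determinedBy_disjoint`, the finite-support form of
`bondPercolation_real_inter_of_disjoint`). The inequality therefore holds with EQUALITY
(`NearLinearTwoClusterDecayShellIndep.real_inter_eq`); degenerate parameters (`n > m`, `m' ≤ m`, …)
need no case split.

Tree API used: `determinedBy_iff`, `DCT16.determinedBy_openConnIn`,
`DCT16.real_inter_of_determinedBy_disjoint`; Mathlib: `Finset.coe_sym2`, `Finset.coe_sdiff`,
`Finset.mk_mem_sym2_iff`, `Finset.mem_sdiff`, `Finset.disjoint_left`, `Sym2.ind`.
-/

noncomputable section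

open MeasureTheory Literature.Probability.Percolation Literature.Probability.LatticeModels

namespace Summit.CriticalPhenomena.PercolationContinuityZ3.Theorems

namespace NearLinearTwoClusterDecayShellIndep

/-- Two configurations agreeing on a pair set `K ⊇ S.sym2` lie in the same connection events
`{x ⟷ y in S}`, simultaneously for all `x y` (pointwise form of `DCT16.determinedBy_openConnIn`). -/
theorem mem_openConnIn_congr {V : Type*} {S : Set V} {K : Set (Sym2 V)} (hK : S.sym2 ⊆ K)
    {ω ω' : BondConfig V} (h : ω ∩ K = ω' ∩ K) (x y : V) :
    ω ∈ openConnIn S x y ↔ ω' ∈ openConnIn S x y :=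
  (determinedBy_iff _ _).1 (DCT16.determinedBy_openConnIn S x y hK) ω ω' h

/-- The two-cluster event `A₂(n, m)` of the box `Λ(m)` is determined by the pairs inside `Λ(m)`,
i.e. by the finite pair set `(box 3 m).sym2`. -/
theorem determinedBy_twoClusterBox (n m : ℕ) :
    DeterminedBy
      {ω : BondConfig (Site 3) | ∃ x ∈ box 3 n, ∃ x' ∈ box 3 n,
        ∃ y ∈ innerBoundary (zdGraph 3) (box 3 m), ∃ y' ∈ innerBoundary (zdGraph 3) (box 3 m),
          ω ∈ openConnIn (↑(box 3 m) : Set (Site 3)) x y ∧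
          ω ∈ openConnIn (↑(box 3 m) : Set (Site 3)) x' y' ∧
          ω ∉ openConnIn (↑(box 3 m) : Set (Site 3)) x x'}
      (↑((box 3 m).sym2) : Set (Sym2 (Site 3))) := by
  rw [determinedBy_iff]
  intro ω ω' h
  have key := mem_openConnIn_congr (S := (↑(box 3 m) : Set (Site 3)))
    (K := (↑((box 3 m).sym2) : Set (Sym2 (Site 3)))) (by rw [Finset.coe_sym2]) h
  simp only [Set.mem_setOf_eq, key]

/-- The shell event `Sh(m, m')` is determined by the pairs inside the shell `Λ(m') ∖ Λ(m)`,
i.e. by the finite pair set `(box 3 m' \ box 3 m).sym2`. -/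
theorem determinedBy_shellTwoCluster (m m' : ℕ) :
    DeterminedBy
      {ω : BondConfig (Site 3) | ∃ u ∈ (↑(box 3 (m + 1)) : Set (Site 3)) \ ↑(box 3 m),
        ∃ u' ∈ (↑(box 3 (m + 1)) : Set (Site 3)) \ ↑(box 3 m),
        ∃ v ∈ innerBoundary (zdGraph 3) (box 3 m'),
        ∃ v' ∈ innerBoundary (zdGraph 3) (box 3 m'),
          ω ∈ openConnIn ((↑(box 3 m') : Set (Site 3)) \ ↑(box 3 m)) u v ∧
          ω ∈ openConnIn ((↑(box 3 m') : Set (Site 3)) \ ↑(box 3 m)) u' v' ∧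
          ω ∉ openConnIn ((↑(box 3 m') : Set (Site 3)) \ ↑(box 3 m)) u u'}
      (↑((box 3 m' \ box 3 m).sym2) : Set (Sym2 (Site 3))) := by
  rw [determinedBy_iff]
  intro ω ω' h
  have key := mem_openConnIn_congr (S := (↑(box 3 m') : Set (Site 3)) \ ↑(box 3 m))
    (K := (↑((box 3 m' \ box 3 m).sym2) : Set (Sym2 (Site 3))))
    (by rw [Finset.coe_sym2, Finset.coe_sdiff]) h
  simp only [Set.mem_setOf_eq, key]

/-- The pair set of the box `Λ(m)` and the pair set of the shell `Λ(m') ∖ Λ(m)` are disjoint: a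
common pair would have an endpoint lying both in `Λ(m)` and outside it. -/
theorem disjoint_sym2_box_shell (m m' : ℕ) :
    Disjoint (box 3 m).sym2 (box 3 m' \ box 3 m).sym2 := by
  rw [Finset.disjoint_left]
  intro z hz hz'
  induction z with
  | h a _ =>
    exact (Finset.mem_sdiff.1 (Finset.mk_mem_sym2_iff.1 hz').1).2 (Finset.mk_mem_sym2_iff.1 hz).1

/-- **Disjoint-shell independence with equality**: `P_p(A₂(n, m) ∩ Sh(m, m')) =
P_p(A₂(n, m)) · P_p(Sh(m, m'))` for every `p, n, m, m'` — the two events are determined by the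
disjoint finite pair sets `(box 3 m).sym2` and `(box 3 m' \ box 3 m).sym2`, hence independent under
the product measure `bondPercolation (zdGraph 3) p` (Grimmett 1999, §2.2). -/
theorem real_inter_eq (p : unitInterval) (n m m' : ℕ) :
    (bondPercolation (zdGraph 3) p).real
        ({ω | ∃ x ∈ box 3 n, ∃ x' ∈ box 3 n, ∃ y ∈ innerBoundary (zdGraph 3) (box 3 m),
            ∃ y' ∈ innerBoundary (zdGraph 3) (box 3 m),
              ω ∈ openConnIn (↑(box 3 m) : Set (Site 3)) x y ∧
              ω ∈ openConnIn (↑(box 3 m) : Set (Site 3)) x' y' ∧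
              ω ∉ openConnIn (↑(box 3 m) : Set (Site 3)) x x'} ∩
          {ω | ∃ u ∈ (↑(box 3 (m + 1)) : Set (Site 3)) \ ↑(box 3 m),
            ∃ u' ∈ (↑(box 3 (m + 1)) : Set (Site 3)) \ ↑(box 3 m),
            ∃ v ∈ innerBoundary (zdGraph 3) (box 3 m'),
            ∃ v' ∈ innerBoundary (zdGraph 3) (box 3 m'),
              ω ∈ openConnIn ((↑(box 3 m') : Set (Site 3)) \ ↑(box 3 m)) u v ∧
              ω ∈ openConnIn ((↑(box 3 m') : Set (Site 3)) \ ↑(box 3 m)) u' v' ∧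
              ω ∉ openConnIn ((↑(box 3 m') : Set (Site 3)) \ ↑(box 3 m)) u u'}) =
      (bondPercolation (zdGraph 3) p).real
          {ω | ∃ x ∈ box 3 n, ∃ x' ∈ box 3 n, ∃ y ∈ innerBoundary (zdGraph 3) (box 3 m),
            ∃ y' ∈ innerBoundary (zdGraph 3) (box 3 m),
              ω ∈ openConnIn (↑(box 3 m) : Set (Site 3)) x y ∧
              ω ∈ openConnIn (↑(box 3 m) : Set (Site 3)) x' y' ∧
              ω ∉ openConnIn (↑(box 3 m) : Set (Site 3)) x x'} *
        (bondPercolation (zdGraph 3) p).real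
          {ω | ∃ u ∈ (↑(box 3 (m + 1)) : Set (Site 3)) \ ↑(box 3 m),
            ∃ u' ∈ (↑(box 3 (m + 1)) : Set (Site 3)) \ ↑(box 3 m),
            ∃ v ∈ innerBoundary (zdGraph 3) (box 3 m'),
            ∃ v' ∈ innerBoundary (zdGraph 3) (box 3 m'),
              ω ∈ openConnIn ((↑(box 3 m') : Set (Site 3)) \ ↑(box 3 m)) u v ∧
              ω ∈ openConnIn ((↑(box 3 m') : Set (Site 3)) \ ↑(box 3 m)) u' v' ∧
              ω ∉ openConnIn ((↑(box 3 m') : Set (Site 3)) \ ↑(box 3 m)) u u'} :=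
  DCT16.real_inter_of_determinedBy_disjoint (zdGraph 3) p (determinedBy_twoClusterBox n m)
    (determinedBy_shellTwoCluster m m') (disjoint_sym2_box_shell m m')

end NearLinearTwoClusterDecayShellIndep

/-- **Stub `stub_shellIndependence` (disjoint-shell independence; product structure).** For bond
percolation on `ℤ³` at any density `p` and all `n, m, m'`:
`P_p(A₂(n, m) ∩ Sh(m, m')) ≤ P_p(A₂(n, m)) · P_p(Sh(m, m'))`, where `A₂(n, m)` (two in-box-distinct
clusters of `Λ(m)` from `Λ(n)` to `∂ⁱⁿΛ(m)`) only reads pairs with both endpoints in `Λ(m)` and the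
shell event `Sh(m, m')` only reads pairs with both endpoints in `Λ(m') ∖ Λ(m)`; the two pair sets are
disjoint, so the events are independent and the bound holds with equality
(`NearLinearTwoClusterDecayShellIndep.real_inter_eq`; Grimmett 1999, §2.2). -/
theorem stub_shellIndependence (p : unitInterval) (n m m' : ℕ) :
    (bondPercolation (zdGraph 3) p).real
        ({ω | ∃ x ∈ box 3 n, ∃ x' ∈ box 3 n, ∃ y ∈ innerBoundary (zdGraph 3) (box 3 m),
            ∃ y' ∈ innerBoundary (zdGraph 3) (box 3 m),
              ω ∈ openConnIn (↑(box 3 m) : Set (Site 3)) x y ∧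
              ω ∈ openConnIn (↑(box 3 m) : Set (Site 3)) x' y' ∧
              ω ∉ openConnIn (↑(box 3 m) : Set (Site 3)) x x'} ∩
          {ω | ∃ u ∈ (↑(box 3 (m + 1)) : Set (Site 3)) \ ↑(box 3 m),
            ∃ u' ∈ (↑(box 3 (m + 1)) : Set (Site 3)) \ ↑(box 3 m),
            ∃ v ∈ innerBoundary (zdGraph 3) (box 3 m'),
            ∃ v' ∈ innerBoundary (zdGraph 3) (box 3 m'),
              ω ∈ openConnIn ((↑(box 3 m') : Set (Site 3)) \ ↑(box 3 m)) u v ∧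
              ω ∈ openConnIn ((↑(box 3 m') : Set (Site 3)) \ ↑(box 3 m)) u' v' ∧
              ω ∉ openConnIn ((↑(box 3 m') : Set (Site 3)) \ ↑(box 3 m)) u u'}) ≤
      (bondPercolation (zdGraph 3) p).real
          {ω | ∃ x ∈ box 3 n, ∃ x' ∈ box 3 n, ∃ y ∈ innerBoundary (zdGraph 3) (box 3 m),
            ∃ y' ∈ innerBoundary (zdGraph 3) (box 3 m),
              ω ∈ openConnIn (↑(box 3 m) : Set (Site 3)) x y ∧
              ω ∈ openConnIn (↑(box 3 m) : Set (Site 3)) x' y' ∧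
              ω ∉ openConnIn (↑(box 3 m) : Set (Site 3)) x x'} *
        (bondPercolation (zdGraph 3) p).real
          {ω | ∃ u ∈ (↑(box 3 (m + 1)) : Set (Site 3)) \ ↑(box 3 m),
            ∃ u' ∈ (↑(box 3 (m + 1)) : Set (Site 3)) \ ↑(box 3 m),
            ∃ v ∈ innerBoundary (zdGraph 3) (box 3 m'),
            ∃ v' ∈ innerBoundary (zdGraph 3) (box 3 m'),
              ω ∈ openConnIn ((↑(box 3 m') : Set (Site 3)) \ ↑(box 3 m)) u v ∧
              ω ∈ openConnIn ((↑(box 3 m') : Set (Site 3)) \ ↑(box 3 m)) u' v' ∧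
              ω ∉ openConnIn ((↑(box 3 m') : Set (Site 3)) \ ↑(box 3 m)) u u'} :=
  (NearLinearTwoClusterDecayShellIndep.real_inter_eq p n m m').le

end Summit.CriticalPhenomena.PercolationContinuityZ3.Theorems

end
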